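import Summits.AnomalousDissipation.AnomalousDissipation.Theorems.TaylorCertificatesKolmogorovFloorResponseDefs

/-!
# LINE-ALGEBRA for the digit-frame response, part 2: the chain `P_{m+1} − P_{m−1} = inc m` and its closure
(negative side of `TaylorCertificates.KolmogorovFloor`, crux stmt-AnomalousDissipation-15122, line `digit-frame-closure`)

cdisprove seat `refuter-cdisprove-stmt-AnomalousDissipation-15122-0` (2026-08-16). Pure algebra over the LANDED closed
forms (`Lam, yC, incC, PC, lamP, lamM, rhoT`). The parity-chain partial sums `P_m` of
`Theorems/TaylorCertificatesKolmogorovFloorResponseDefs.lean` satisfy `P_{m+1} − P_{m−1} = inc m` at every even site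
`|m| ≤ 2J+2`: for `m ≠ 0` by the nested `range (J+2)` filters (`sum_filter_pred_eq`, `sum_filter_pred_eq_neg`), at
`m = 0` by the CLOSURE `λ₊G₊ + λ₋G₋ = ρ̃` (`closure`), since the two window sums of `y` are `λ₊G₊` and `λ₋G₋`
(`sum_yC_pos`, `sum_yC_neg`) and every odd site of the window is counted by its two even neighbours.
-/

noncomputable section

set_option linter.dupNamespace false

open Finset
open scoped BigOperators ComplexConjugate

namespace Summit.AnomalousDissipation.AnomalousDissipation.Theorems.KolmogorovFloor.Response

section Chain

variable (d : LineData) (F : LineForce) (J : ℕ)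

/-! ### The two window sums of `y` -/

/-- `Σ_{i=0}^{J} y_{2i+1} = λ₊ G₊`. -/
theorem sum_yC_pos : ∑ i ∈ range (J + 1), yC d F J (2 * (i : ℤ) + 1) = lamP d F J * ((d.Gp J : ℝ) : ℂ) := by
  have hterm : ∀ i ∈ range (J + 1), yC d F J (2 * (i : ℤ) + 1) = lamP d F J * ((d.E (2 * (i : ℤ) + 1) : ℤ) : ℂ)⁻¹ := by
    intro i hi
    rw [mem_range] at hi
    have hiJ : (i : ℤ) ≤ J := by exact_mod_cast Nat.lt_succ_iff.mp hi
    have hwin : |2 * (i : ℤ) + 1| ≤ 2 * (J : ℤ) + 1 := by rw [abs_of_nonneg (by positivity)]; omega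
    rw [yC, Lam, if_neg (by omega), if_pos (by positivity), div_eq_mul_inv]
  rw [sum_congr rfl hterm, ← mul_sum, LineData.Gp]
  push_cast
  rfl

/-- `Σ_{i=0}^{J} y_{−(2i+1)} = λ₋ G₋`. -/
theorem sum_yC_neg : ∑ i ∈ range (J + 1), yC d F J (-(2 * (i : ℤ) + 1)) = lamM d F J * ((d.Gm J : ℝ) : ℂ) := by
  have hterm : ∀ i ∈ range (J + 1), yC d F J (-(2 * (i : ℤ) + 1)) =
      lamM d F J * ((d.E (-(2 * (i : ℤ) + 1)) : ℤ) : ℂ)⁻¹ := by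
    intro i hi
    rw [mem_range] at hi
    have hiJ : (i : ℤ) ≤ J := by exact_mod_cast Nat.lt_succ_iff.mp hi
    have hwin : |(-(2 * (i : ℤ) + 1))| ≤ 2 * (J : ℤ) + 1 := by rw [abs_of_neg (by omega)]; omega
    have h1 : ¬ ((-(2 * (i : ℤ) + 1)) % 2 = 0 ∨ 2 * (J : ℤ) + 1 < |(-(2 * (i : ℤ) + 1))|) := by omega
    have h2 : ¬ (0 < -(2 * (i : ℤ) + 1)) := by omega
    rw [yC, Lam, if_neg h1, if_neg h2, div_eq_mul_inv]
  rw [sum_congr rfl hterm, ← mul_sum, LineData.Gm]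
  push_cast
  rfl

/-- **The closure**: `λ₊ G₊ + λ₋ G₋ = ρ̃` (the definition of the two sheet constants; `G = G₊ + G₋ ≠ 0`). -/
theorem closure (hG : d.G J ≠ 0) :
    lamP d F J * ((d.Gp J : ℝ) : ℂ) + lamM d F J * ((d.Gm J : ℝ) : ℂ) = rhoT d F := by
  have hG' : ((d.G J : ℝ) : ℂ) ≠ 0 := by exact_mod_cast hG
  have hGdef : ((d.G J : ℝ) : ℂ) = ((d.Gp J : ℝ) : ℂ) + ((d.Gm J : ℝ) : ℂ) := by
    rw [LineData.G]; push_cast; ring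
  unfold lamP lamM
  rw [hGdef] at hG' ⊢
  field_simp
  ring

/-! ### Splitting the nested filters -/

/-- Removing the lowest admissible site from a positive chain sum (even `0 < m ≤ 2J+2`). -/
theorem sum_filter_pred_eq {m : ℤ} (heven : m % 2 = 0) (hpos : 0 < m) (hle : m ≤ 2 * (J : ℤ) + 2) (g : ℕ → ℂ) :
    ∑ i ∈ (range (J + 2)).filter (fun i : ℕ => m - 1 < 2 * (i : ℤ)), g i =
      g (m.toNat / 2) + ∑ i ∈ (range (J + 2)).filter (fun i : ℕ => m + 1 < 2 * (i : ℤ)), g i := by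
  rw [sum_filter, sum_filter]
  have hpt : ∀ i ∈ range (J + 2), (if m - 1 < 2 * (i : ℤ) then g i else 0) =
      (if i = m.toNat / 2 then g i else 0) + (if m + 1 < 2 * (i : ℤ) then g i else 0) := by
    intro i _
    by_cases h1 : i = m.toNat / 2
    · have h2 : 2 * (i : ℤ) = m := by subst h1; omega
      rw [if_pos (by omega), if_pos h1, if_neg (by omega), add_zero]
    · have h2 : 2 * (i : ℤ) ≠ m := by intro h; apply h1; omega
      by_cases h3 : m + 1 < 2 * (i : ℤ)
      · rw [if_pos (by omega), if_neg h1, if_pos h3, zero_add]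
      · rw [if_neg (by omega), if_neg h1, if_neg h3, zero_add]
  rw [sum_congr rfl hpt, sum_add_distrib, sum_ite_eq']
  have hmem : m.toNat / 2 ∈ range (J + 2) := by rw [mem_range]; omega
  rw [if_pos hmem]

/-- Removing the highest admissible site from a negative chain sum (even `−(2J+2) ≤ m < 0`). -/
theorem sum_filter_pred_eq_neg {m : ℤ} (heven : m % 2 = 0) (hneg : m < 0) (hle : -(2 * (J : ℤ) + 2) ≤ m) (g : ℕ → ℂ) :
    ∑ i ∈ (range (J + 2)).filter (fun i : ℕ => -(m + 1) < 2 * (i : ℤ)), g i =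
      g ((-m).toNat / 2) + ∑ i ∈ (range (J + 2)).filter (fun i : ℕ => -(m - 1) < 2 * (i : ℤ)), g i := by
  rw [sum_filter, sum_filter]
  have hpt : ∀ i ∈ range (J + 2), (if -(m + 1) < 2 * (i : ℤ) then g i else 0) =
      (if i = (-m).toNat / 2 then g i else 0) + (if -(m - 1) < 2 * (i : ℤ) then g i else 0) := by
    intro i _
    by_cases h1 : i = (-m).toNat / 2
    · have h2 : 2 * (i : ℤ) = -m := by subst h1; omega
      rw [if_pos (by omega), if_pos h1, if_neg (by omega), add_zero]
    · have h2 : 2 * (i : ℤ) ≠ -m := by intro h; apply h1; omega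
      by_cases h3 : -(m - 1) < 2 * (i : ℤ)
      · rw [if_pos (by omega), if_neg h1, if_pos h3, zero_add]
      · rw [if_neg (by omega), if_neg h1, if_neg h3, zero_add]
  rw [sum_congr rfl hpt, sum_add_distrib, sum_ite_eq']
  have hmem : (-m).toNat / 2 ∈ range (J + 2) := by rw [mem_range]; omega
  rw [if_pos hmem]

/-- The chain sums at `m = ±1` run over `i = 1, …, J+1`. -/
theorem sum_filter_one_lt (g : ℕ → ℂ) :
    ∑ i ∈ (range (J + 2)).filter (fun i : ℕ => (1 : ℤ) < 2 * (i : ℤ)), g i = ∑ i ∈ range (J + 1), g (i + 1) := by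
  rw [sum_filter, sum_range_succ' (fun i => if (1 : ℤ) < 2 * (i : ℤ) then g i else 0)]
  simp only [Nat.cast_zero, mul_zero, show ¬ ((1 : ℤ) < 0) by norm_num, if_false, add_zero]
  refine sum_congr rfl fun i _ => ?_
  rw [if_pos (by push_cast; omega)]

/-! ### The chain -/

/-- The chain at a positive even site `0 < m ≤ 2J+2`. -/
theorem chain_pos {m : ℤ} (heven : m % 2 = 0) (hpos : 0 < m) (hle : m ≤ 2 * (J : ℤ) + 2) :
    PC d F J (m + 1) - PC d F J (m - 1) = incC d F J m := by
  have hP1 : PC d F J (m + 1) = -∑ i ∈ (range (J + 2)).filter (fun i : ℕ => m + 1 < 2 * (i : ℤ)), incC d F J (2 * (i : ℤ)) := by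
    rw [PC, if_neg (by omega), if_pos (by omega)]
  have hP2 : PC d F J (m - 1) = -∑ i ∈ (range (J + 2)).filter (fun i : ℕ => m - 1 < 2 * (i : ℤ)), incC d F J (2 * (i : ℤ)) := by
    rw [PC, if_neg (by omega), if_pos (by omega)]
  rw [hP1, hP2, sum_filter_pred_eq J heven hpos hle]
  have hcast : (2 * ((m.toNat / 2 : ℕ) : ℤ)) = m := by omega
  rw [hcast]
  ring

/-- The chain at a negative even site `−(2J+2) ≤ m < 0`. -/
theorem chain_neg {m : ℤ} (heven : m % 2 = 0) (hneg : m < 0) (hle : -(2 * (J : ℤ) + 2) ≤ m) :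
    PC d F J (m + 1) - PC d F J (m - 1) = incC d F J m := by
  have hP1 : PC d F J (m + 1) = ∑ i ∈ (range (J + 2)).filter (fun i : ℕ => -(m + 1) < 2 * (i : ℤ)), incC d F J (-(2 * (i : ℤ))) := by
    rw [PC, if_neg (by omega), if_neg (by omega)]
  have hP2 : PC d F J (m - 1) = ∑ i ∈ (range (J + 2)).filter (fun i : ℕ => -(m - 1) < 2 * (i : ℤ)), incC d F J (-(2 * (i : ℤ))) := by
    rw [PC, if_neg (by omega), if_neg (by omega)]
  rw [hP1, hP2, sum_filter_pred_eq_neg J heven hneg hle]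
  have hcast : (-(2 * (((-m).toNat / 2 : ℕ) : ℤ))) = m := by omega
  rw [hcast]
  ring

/-- The chain at the forced site `m = 0` is the CLOSURE. -/
theorem chain_zero (ha : d.a ≠ 0) (hc : d.c ≠ 0) (hX2 : d.X2 ≠ 0) (he2 : d.e2 ≠ 0) (hG : d.G J ≠ 0) :
    PC d F J 1 - PC d F J (-1) = incC d F J 0 := by
  have ha' : ((d.a : ℤ) : ℂ) ≠ 0 := by exact_mod_cast ha
  have hc' : ((d.c : ℤ) : ℂ) ≠ 0 := by exact_mod_cast hc
  have hX2' : ((d.X2 : ℤ) : ℂ) ≠ 0 := by exact_mod_cast hX2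
  have he2' : ((d.e2 : ℤ) : ℂ) ≠ 0 := by exact_mod_cast he2
  -- the two chain sums, reindexed over `i = 0, …, J` (site `2(i+1)`)
  have hP1 : PC d F J 1 = -∑ i ∈ range (J + 1), incC d F J (2 * ((i : ℤ) + 1)) := by
    rw [PC, if_neg (by omega), if_pos (by omega), sum_filter_one_lt J]
    rfl
  have hP2 : PC d F J (-1) = ∑ i ∈ range (J + 1), incC d F J (-(2 * ((i : ℤ) + 1))) := by
    rw [PC, if_neg (by omega), if_neg (by omega)]
    simp only [neg_neg]
    rw [sum_filter_one_lt J]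
    refine sum_congr rfl fun i _ => ?_
    simp only [Nat.cast_add, Nat.cast_one]
  -- unfolding `inc` at the non-zero even sites
  have hinc : ∀ i : ℕ, incC d F J (2 * ((i : ℤ) + 1)) =
      ((d.X2 : ℂ) * (d.c : ℂ) * (d.e2 : ℂ) / (d.a : ℂ)) *
        (yC d F J (2 * (i : ℤ) + 1) + yC d F J (2 * ((i : ℤ) + 1) + 1)) := by
    intro i
    rw [incC, if_neg (by omega), sub_zero]
    congr 2; ring
  have hinc' : ∀ i : ℕ, incC d F J (-(2 * ((i : ℤ) + 1))) =
      ((d.X2 : ℂ) * (d.c : ℂ) * (d.e2 : ℂ) / (d.a : ℂ)) *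
        (yC d F J (-(2 * ((i : ℤ) + 1) + 1)) + yC d F J (-(2 * (i : ℤ) + 1))) := by
    intro i
    rw [incC, if_neg (by omega), sub_zero]
    congr 2
  -- the shifted window sums
  obtain ⟨Sp, hSp⟩ : ∃ Sp : ℂ, Sp = ∑ i ∈ range (J + 1), yC d F J (2 * (i : ℤ) + 1) := ⟨_, rfl⟩
  obtain ⟨Sm, hSm⟩ : ∃ Sm : ℂ, Sm = ∑ i ∈ range (J + 1), yC d F J (-(2 * (i : ℤ) + 1)) := ⟨_, rfl⟩
  have hout_p : yC d F J (2 * ((J : ℤ) + 1) + 1) = 0 := by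
    rw [yC, Lam, if_pos (Or.inr (by rw [abs_of_nonneg (by positivity)]; omega)), zero_div]
  have hout_m : yC d F J (-(2 * ((J : ℤ) + 1) + 1)) = 0 := by
    rw [yC, Lam, if_pos (Or.inr (by rw [abs_of_neg (by omega)]; omega)), zero_div]
  have hshift_p : ∑ i ∈ range (J + 1), yC d F J (2 * ((i : ℤ) + 1) + 1) = Sp - yC d F J 1 := by
    have h1 := sum_range_succ' (fun i : ℕ => yC d F J (2 * (i : ℤ) + 1)) (J + 1)
    have h2 := sum_range_succ (fun i : ℕ => yC d F J (2 * (i : ℤ) + 1)) (J + 1)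
    simp only [Nat.cast_zero, mul_zero, zero_add, Nat.cast_add, Nat.cast_one] at h1 h2
    rw [hout_p, add_zero] at h2
    rw [h2, ← hSp] at h1
    have h3 : ∑ i ∈ range (J + 1), yC d F J (2 * ((i : ℤ) + 1) + 1) = Sp + 0 - yC d F J 1 := by
      rw [add_zero]; exact eq_sub_of_add_eq h1.symm
    rw [h3, add_zero]
  have hshift_m : ∑ i ∈ range (J + 1), yC d F J (-(2 * ((i : ℤ) + 1) + 1)) = Sm - yC d F J (-1) := by
    have h1 := sum_range_succ' (fun i : ℕ => yC d F J (-(2 * (i : ℤ) + 1))) (J + 1)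
    have h2 := sum_range_succ (fun i : ℕ => yC d F J (-(2 * (i : ℤ) + 1))) (J + 1)
    simp only [Nat.cast_zero, mul_zero, zero_add, Nat.cast_add, Nat.cast_one] at h1 h2
    rw [hout_m, add_zero] at h2
    rw [h2, ← hSm] at h1
    exact eq_sub_of_add_eq h1.symm
  -- assemble
  have hcl : Sp + Sm = rhoT d F := by
    rw [hSp, hSm, sum_yC_pos, sum_yC_neg]; exact closure d F J hG
  have hrhoT : rhoT d F * (2 * (d.X2 : ℂ) * (d.c : ℂ) * (d.e2 : ℂ)) = rhoC d F * (d.a : ℂ) := by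
    unfold rhoT; field_simp
  rw [hP1, hP2]
  simp_rw [hinc, hinc']
  rw [← mul_sum, ← mul_sum, sum_add_distrib, sum_add_distrib, ← hSp, hshift_p, hshift_m, ← hSm]
  rw [incC, if_pos rfl]
  have e1 : yC d F J (0 - 1) = yC d F J (-1) := by norm_num
  have e2 : yC d F J (0 + 1) = yC d F J 1 := by norm_num
  rw [e1, e2]
  rw [← hcl] at hrhoT
  field_simp
  linear_combination (-1) * hrhoT

/-- **The chain at every even site `|m| ≤ 2J+2`.** -/
theorem chain (ha : d.a ≠ 0) (hc : d.c ≠ 0) (hX2 : d.X2 ≠ 0) (he2 : d.e2 ≠ 0) (hG : d.G J ≠ 0)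
    {m : ℤ} (heven : m % 2 = 0) (hwin : |m| ≤ 2 * (J : ℤ) + 2) :
    PC d F J (m + 1) - PC d F J (m - 1) = incC d F J m := by
  rcases lt_trichotomy m 0 with hneg | rfl | hpos
  · exact chain_neg d F J heven hneg (by rw [abs_of_neg hneg] at hwin; omega)
  · exact chain_zero d F J ha hc hX2 he2 hG
  · exact chain_pos d F J heven hpos (by rw [abs_of_pos hpos] at hwin; exact hwin)

end Chain

end Summit.AnomalousDissipation.AnomalousDissipation.Theorems.KolmogorovFloor.Response
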